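import Literature.AlgebraicGeometry.Motives.HodgeLieWeightOneRankTwelveLeviThree
import Literature.AlgebraicGeometry.Motives.HodgeLieWeightOneRankEightSymplectic
import HarnessLib

/-!
# The Θ-subalgebra theorem in rank TWELVE: every admissible `𝔤` is `𝔰𝔭(V, ψ)`, rational descent, `Lie Hg = 𝔰𝔭₁₂`, and Theorem L-Sp
# (Moonen–Zarhin 1999 (2.3), §3 (3.1) for simple abelian sixfolds with `End⁰ = ℚ`, type I(1); Deligne's minimality, LNM 900 I Prop. 3.4)

Topic `Literature/AlgebraicGeometry/Motives` (namespace `Literature.AlgebraicGeometry.Motives.HodgeStructure`).  Theorems only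
(no definition, no named fact; D-0026), no `sorry`.  Written for the cell `pub-hodgeav-hg6` (LADDER-HodgeAV row 2, TABLE X row 1
`g6.I(1)`, the ROW-1 CONSUMER (a), eng-2 lineage g6; honest framing of that cell: HC / HC_AV / HC_CM NOT proved — this file is
unconditional Hodge–Lie linear algebra).  It is the VERBATIM rank-twelve twin (`14 ↦ 12`) of the tree's
`HodgeThetaSubalgebraSymplecticRankFourteenSkew` + `HodgeThetaSubalgebraSymplecticRankFourteenHodge` (lit gen 83, R63) and of
`HodgeThetaSubalgebraSymplecticRankTenSkew` + `…RankTenHodge` (lit gen 67–68, R44), on top of the cell's rank-twelve theorem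
`mem_hodgeLieC_of_skew_rankTwelve` (`HodgeLieWeightOneRankTwelveLeviThree`: `End_Hdg = ℚ`, `dim_ℚ V = 12` ⟹ `Lie Hg ⊗ ℂ ∋` every
`ψ_ℂ`-skew operator; classification-free: minimal raising tripotents of rank `1, 2, 3, 4, 5, 6` and products excluded one by one),
so that the `AVSlots` assembly `GenericAbelianFivefoldPowersHodgeClasses` ports verbatim to dimension six
(`GenericAbelianSixfoldPowersHodgeClasses`).  The passage from `Lie Hg` to an ARBITRARY admissible `𝔤` is the tree's rank-generic
`mem_spanC_of_skew_of_hodgeLieC` / `wordDerAt_eq_zero_of_skew_of_hodgeLieC` (`HodgeLieWeightOneRankEightSymplectic` §1: Deligne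
rigidity `hodgeLie_rigid` applied to `𝔤 ∩ Lie Hg`).

* §1 **`SymplecticThetaTwelve.mem_spanC_of_skew`** — `H` effective polarized of weight `1`, `dim V = 12`, `End_Hdg = ℚ`;
  `𝔤 ⊆ 𝔰𝔭(V, ψ)` rational, bracket-closed, `Θ ∈ 𝔤_ℂ`: every `ψ_ℂ`-skew operator lies in `𝔤_ℂ`; `mem_spanC_iff_skew`.
* §2 **`SymplecticThetaTwelve.mem_iff_skew`** (descent over `ℚ`), **`mem_hodgeLie_iff_skew`** (`Lie Hg = 𝔰𝔭₁₂`: a rational operator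
  is in `Lie Hg` iff it is `ψ`-skew), **`eq_hodgeLie`** (Deligne minimality: `Lie Hg` is the only admissible `𝔤`).
* §3 **`SymplecticThetaTwelve.wordDerAt_eq_zero_of_skew`** — THEOREM L-Sp: a rational coefficient tensor killed by `Θ` is killed by
  every `ψ_ℂ`-skew operator (the Lie step of `B(Xⁿ) = D(Xⁿ)`).

Moonen–Zarhin, Math. Ann. 315 (1999) §2 (2.3) [corpus: paper:arxiv-math_9901113 p0005]: «Type I(1): … `Hg(X) = Sp(V,φ)`»; §3 (3.1)
(`g = 6`, `End⁰ = ℚ`): «`Hg = Sp₁₂`»; (1.8): «`Hg(X) = Sp_D(V,φ)` ⟺ `D(Xⁿ) = B(Xⁿ)` for all `n`».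

## References

* [MoonenZarhin1999LowDim] B. Moonen, Yu. Zarhin, Math. Ann. 315 (1999), §1 (1.8), §2 (2.3), p. 715, §3 (3.1).
* [Deligne1982HodgeCycles] P. Deligne, Hodge cycles on abelian varieties, LNM 900 (1982), I §3 Prop. 3.4, Prop. 3.6.
* [Milne1999LefschetzClasses] J. S. Milne, Lefschetz classes on abelian varieties, Duke Math. J. 96 (1999), Prop. 3.6 (a).
* [Huybrechts2016K3] D. Huybrechts, Lectures on K3 surfaces (2016), Thm. 3.3.9.
-/

open scoped TensorProduct

namespace Literature.AlgebraicGeometry.Motives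

open Module

namespace HodgeStructure

universe u

variable {V : Type u} [AddCommGroup V] [Module ℚ V] [Module.Finite ℚ V] [HodgeTensorFacts.{u, u}] {n : ℤ}

/-! ## §1 Every admissible `𝔤` is `𝔰𝔭(V, ψ)` after complexification -/

/-- **Theorem (`𝔤_ℂ = 𝔰𝔭(V, ψ)_ℂ` for a weight-one Hodge structure of rank TWELVE with `End_Hdg = ℚ`; the Lie step of
`Hg(X) = Sp₁₂` for simple abelian sixfolds with `End⁰(X) = ℚ`).**  Same signature as `SymplecticThetaFourteen.mem_spanC_of_skew`
with `14 ↦ 12`: for `𝔤 ⊆ 𝔰𝔭(V, ψ)` rational, bracket-closed, with `Θ ∈ 𝔤_ℂ`, every `ψ_ℂ`-skew operator of `V_ℂ` lies in `𝔤_ℂ`.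
PROOF: `(Lie Hg)_ℂ` contains every skew operator (`mem_hodgeLieC_of_skew_rankTwelve`), and this propagates to every admissible
`𝔤` by Deligne's rigidity applied to `𝔤 ∩ Lie Hg` (`mem_spanC_of_skew_of_hodgeLieC`).
[cite: MoonenZarhin1999LowDim, §2 (2.3) and §3 (3.1)] [cite: Deligne1982HodgeCycles, I §3 Prop. 3.4] -/
theorem SymplecticThetaTwelve.mem_spanC_of_skew (H : HodgeStructure V n) (hn : n = 1) (heff : H.IsEffective)
    (ψ : H.Polarization) (hE : ∀ a ∈ H.endAlg, ∃ x : ℚ, a = x • (1 : Module.End ℚ V)) (hV : Module.finrank ℚ V = 12)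
    (𝔤 : Submodule ℚ (Module.End ℚ V)) (hbr : ∀ X ∈ 𝔤, ∀ X' ∈ 𝔤, X * X' - X' * X ∈ 𝔤)
    {Θ : Module.End ℂ (ℂ ⊗[ℚ] V)} (hΘ : ∀ p, ∀ x ∈ H.piece p (n - p), Θ x = ((2 * p - n : ℤ) : ℂ) • x)
    (hΘ𝔤 : Θ ∈ spanC 𝔤) (_hskew : ∀ X ∈ 𝔤, ∀ v w, ψ.form (X v) w + ψ.form v (X w) = 0)
    {Y : Module.End ℂ (ℂ ⊗[ℚ] V)} (hY : ∀ x y, ψ.form.baseChange ℂ (Y x) y + ψ.form.baseChange ℂ x (Y y) = 0) :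
    Y ∈ spanC 𝔤 :=
  mem_spanC_of_skew_of_hodgeLieC H ψ (mem_hodgeLieC_of_skew_rankTwelve H hn heff ψ hE hV) 𝔤 hbr hΘ hΘ𝔤 hY

/-- **`𝔤_ℂ = 𝔰𝔭(V, ψ)_ℂ` as an equivalence** (rank twelve). [cite: MoonenZarhin1999LowDim, §2 (2.3)] -/
theorem SymplecticThetaTwelve.mem_spanC_iff_skew (H : HodgeStructure V n) (hn : n = 1) (heff : H.IsEffective)
    (ψ : H.Polarization) (hE : ∀ a ∈ H.endAlg, ∃ x : ℚ, a = x • (1 : Module.End ℚ V)) (hV : Module.finrank ℚ V = 12)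
    (𝔤 : Submodule ℚ (Module.End ℚ V)) (hbr : ∀ X ∈ 𝔤, ∀ X' ∈ 𝔤, X * X' - X' * X ∈ 𝔤)
    {Θ : Module.End ℂ (ℂ ⊗[ℚ] V)} (hΘ : ∀ p, ∀ x ∈ H.piece p (n - p), Θ x = ((2 * p - n : ℤ) : ℂ) • x)
    (hΘ𝔤 : Θ ∈ spanC 𝔤) (hskew : ∀ X ∈ 𝔤, ∀ v w, ψ.form (X v) w + ψ.form v (X w) = 0)
    (Y : Module.End ℂ (ℂ ⊗[ℚ] V)) :
    Y ∈ spanC 𝔤 ↔ ∀ x y, ψ.form.baseChange ℂ (Y x) y + ψ.form.baseChange ℂ x (Y y) = 0 :=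
  ⟨fun hY => ThetaSubalgebra.formBaseChange_add_eq_zero_of_mem_spanC ψ hskew hY,
    fun hY => SymplecticThetaTwelve.mem_spanC_of_skew H hn heff ψ hE hV 𝔤 hbr hΘ hΘ𝔤 hskew hY⟩

/-! ## §2 Rational descent: `𝔤 = 𝔰𝔭(V, ψ)` over `ℚ`, `Lie Hg = 𝔰𝔭₁₂`, Deligne minimality -/

/-- **`𝔤 = 𝔰𝔭(V, ψ)` over `ℚ`** (rank twelve; descent `X ∈ 𝔤 ↔ X_ℂ ∈ 𝔤_ℂ`).
[cite: MoonenZarhin1999LowDim, §2 (2.3)]; [cite: Deligne1982HodgeCycles, I §3 (proof of Prop. 3.4)] -/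
theorem SymplecticThetaTwelve.mem_iff_skew (H : HodgeStructure V n) (hn : n = 1)
    (heff : H.IsEffective) (ψ : H.Polarization) (hE : ∀ a ∈ H.endAlg, ∃ x : ℚ, a = x • (1 : Module.End ℚ V))
    (hV : Module.finrank ℚ V = 12) (𝔤 : Submodule ℚ (Module.End ℚ V))
    (hbr : ∀ X ∈ 𝔤, ∀ X' ∈ 𝔤, X * X' - X' * X ∈ 𝔤) {Θ : Module.End ℂ (ℂ ⊗[ℚ] V)}
    (hΘ : ∀ p, ∀ x ∈ H.piece p (n - p), Θ x = ((2 * p - n : ℤ) : ℂ) • x) (hΘ𝔤 : Θ ∈ spanC 𝔤)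
    (hskew : ∀ X ∈ 𝔤, ∀ v w, ψ.form (X v) w + ψ.form v (X w) = 0) (X : Module.End ℚ V) :
    X ∈ 𝔤 ↔ ∀ v w, ψ.form (X v) w + ψ.form v (X w) = 0 := by
  refine ⟨hskew X, fun hX => ?_⟩
  exact mem_of_baseChange_mem_spanC 𝔤 (SymplecticThetaTwelve.mem_spanC_of_skew H hn heff ψ hE hV 𝔤 hbr hΘ hΘ𝔤
    hskew (ThetaSubalgebra.formBaseChange_add_eq_zero_of_skew ψ hX))

/-- **`Lie Hg(H) = 𝔰𝔭(V, ψ)` (Moonen–Zarhin 1999 (2.3), Type I(1), `g = 6`, §3 (3.1): "`Hg = Sp₁₂`", infinitesimally):** for an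
effective polarized weight-one `H` with `dim V = 12` and `End_Hdg(V) = ℚ`, a rational operator lies in the Lie algebra of the
Hodge group iff it is `ψ`-skew.  `Lie Hg(H)` is admissible: bracket-closed (`commutator_mem_hodgeLie`), `Θ ∈ Lie Hg ⊗ ℂ`
(`mem_hodgeLieC_of_forall_piece`), `ψ`-skew (`form_apply_add_eq_zero_of_mem_hodgeLie`).
[cite: MoonenZarhin1999LowDim, §2 (2.3), §3 (3.1) and (1.8)] [cite: Huybrechts2016K3, Thm. 3.3.9 (proof, p. 67)] -/
theorem SymplecticThetaTwelve.mem_hodgeLie_iff_skew (H : HodgeStructure V n)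
    (hn : n = 1) (heff : H.IsEffective) (ψ : H.Polarization) (hE : ∀ a ∈ H.endAlg, ∃ x : ℚ, a = x • (1 : Module.End ℚ V))
    (hV : Module.finrank ℚ V = 12) (X : Module.End ℚ V) :
    X ∈ H.hodgeLie ↔ ∀ v w, ψ.form (X v) w + ψ.form v (X w) = 0 := by
  obtain ⟨Θ, hΘ⟩ := exists_hodgeTheta H
  have hΘ𝔤 : Θ ∈ spanC H.hodgeLie := (hodgeLieC_eq_spanC H) ▸ H.mem_hodgeLieC_of_forall_piece hΘ
  exact SymplecticThetaTwelve.mem_iff_skew H hn heff ψ hE hV H.hodgeLie (fun X hX Y hY => H.commutator_mem_hodgeLie hX hY)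
    hΘ hΘ𝔤 (fun X hX => form_apply_add_eq_zero_of_mem_hodgeLie ψ hX) X

/-- **`𝔤 = Lie Hg(H)`: `Lie Hg(H)` is the only rational Lie subalgebra of `𝔰𝔭(V, ψ)` whose complexification
contains `Θ`** (Deligne's minimality, LNM 900 I Prop. 3.4, in Lie form, for the generic rank-twelve case).
[cite: Deligne1982HodgeCycles, I §3 Prop. 3.4] [cite: MoonenZarhin1999LowDim, §2 (2.3)] -/
theorem SymplecticThetaTwelve.eq_hodgeLie (H : HodgeStructure V n)
    (hn : n = 1) (heff : H.IsEffective) (ψ : H.Polarization) (hE : ∀ a ∈ H.endAlg, ∃ x : ℚ, a = x • (1 : Module.End ℚ V))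
    (hV : Module.finrank ℚ V = 12) (𝔤 : Submodule ℚ (Module.End ℚ V))
    (hbr : ∀ X ∈ 𝔤, ∀ X' ∈ 𝔤, X * X' - X' * X ∈ 𝔤) {Θ : Module.End ℂ (ℂ ⊗[ℚ] V)}
    (hΘ : ∀ p, ∀ x ∈ H.piece p (n - p), Θ x = ((2 * p - n : ℤ) : ℂ) • x) (hΘ𝔤 : Θ ∈ spanC 𝔤)
    (hskew : ∀ X ∈ 𝔤, ∀ v w, ψ.form (X v) w + ψ.form v (X w) = 0) : 𝔤 = H.hodgeLie := by
  ext X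
  rw [SymplecticThetaTwelve.mem_iff_skew H hn heff ψ hE hV 𝔤 hbr hΘ hΘ𝔤 hskew,
    SymplecticThetaTwelve.mem_hodgeLie_iff_skew H hn heff ψ hE hV]

/-! ## §3 Theorem L-Sp in rank twelve: rational tensors killed by `Θ` are killed by `𝔰𝔭(V_ℂ, ψ_ℂ)` -/

section AnnLie

open Literature.RepresentationTheory.GeneralLinear Literature.NumberTheory.DiophantineGeometry

variable {M N k : ℕ}

/-- **Theorem L-Sp (invariance of rational tensors under `𝔰𝔭(V_ℂ, ψ_ℂ)`; the Lie step of `B(Xⁿ) = D(Xⁿ)` for a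
generic abelian SIXFOLD).**  In the setting of `SymplecticThetaTwelve.mem_spanC_of_skew`, let `q` be a rational
coefficient tensor (letters: slots `Fin k` × a `ℚ`-basis `eQ` of `V`) killed — slice by slice, diagonally — by
the matrix of the Hodge operator `Θ`.  Then `q` is killed by the matrix of EVERY `ψ_ℂ`-skew operator `Y` of
`V_ℂ`: the rational Lie algebra `𝔞 ⊆ 𝔰𝔭(V, ψ)` of operators killing `q` (`annLie`, with `End_Hdg(V)` as commuting family)
is bracket-closed with `Θ ∈ 𝔞_ℂ` by descent (`mem_spanC_annLie`, Deligne LNM 900 I §3), so `𝔞_ℂ = 𝔰𝔭(V_ℂ, ψ_ℂ) ∋ Y`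
(`wordDerAt_eq_zero_of_skew_of_hodgeLieC` over `mem_hodgeLieC_of_skew_rankTwelve`), and `𝔞_ℂ` kills `q_ℂ`.  (MZ99 (1.8):
«`Hg(X) = Sp_D(V,φ)` ⟺ … `D(Xⁿ) = B(Xⁿ)` for all `n`»; the passage to divisor classes is by the invariant theory of `Sp`,
Milne 1999 Prop. 3.6 (a).) [cite: MoonenZarhin1999LowDim, §1 (1.8), §2 (2.3) and §3 (3.1)]
[cite: Deligne1982HodgeCycles, I §3 (proof of Prop. 3.4)] [cite: Milne1999LefschetzClasses, Prop. 3.6 (a)] -/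
theorem SymplecticThetaTwelve.wordDerAt_eq_zero_of_skew
    (H : HodgeStructure V n) (hn : n = 1) (heff : H.IsEffective) (ψ : H.Polarization)
    (hE : ∀ a ∈ H.endAlg, ∃ x : ℚ, a = x • (1 : Module.End ℚ V)) (hV : Module.finrank ℚ V = 12)
    (eQ : Module.Basis (Fin M) ℚ V) (q : (Fin N → Fin k × Fin M) → ℚ) {Θ : Module.End ℂ (ℂ ⊗[ℚ] V)}
    (hΘ : ∀ p, ∀ x ∈ H.piece p (n - p), Θ x = ((2 * p - n : ℤ) : ℂ) • x)
    (hΘq : ∀ u : Fin N → Fin k, wordDerAt ℂ (fun _ : Fin N =>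
      LinearMap.toMatrix (Algebra.TensorProduct.basis ℂ eQ) (Algebra.TensorProduct.basis ℂ eQ) Θ)
      (wordSlice (fun w => algebraMap ℚ ℂ (q w)) u) = 0)
    {Y : Module.End ℂ (ℂ ⊗[ℚ] V)}
    (hYskew : ∀ x y, ψ.form.baseChange ℂ (Y x) y + ψ.form.baseChange ℂ x (Y y) = 0) (u : Fin N → Fin k) :
    wordDerAt ℂ (fun _ : Fin N =>
      LinearMap.toMatrix (Algebra.TensorProduct.basis ℂ eQ) (Algebra.TensorProduct.basis ℂ eQ) Y)
      (wordSlice (fun w => algebraMap ℚ ℂ (q w)) u) = 0 :=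
  wordDerAt_eq_zero_of_skew_of_hodgeLieC H ψ (mem_hodgeLieC_of_skew_rankTwelve H hn heff ψ hE hV) eQ q hΘ hΘq hYskew u

end AnnLie

end HodgeStructure

end Literature.AlgebraicGeometry.Motives
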